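import Summits.HodgeConjecture.Ring2.NonSimpleFivefoldsResidual
import Literature.AlgebraicGeometry.HodgeTheory.CentreTimesCMCurveProductSpan
import HarnessLib

/-!
# Non-simple complex abelian FIVEFOLDS, part 4: the row (5.11) `E_k × E_{k'} × T` DISCHARGED — Moonen–Zarhin 1999 Thm. 0.2 (4) for non-simple fivefolds modulo the single row (5.10)

Cell `pub-hodge-ring2` (HONEST FRAMING: research route conditional on HC_CM; not a corollary; Q11.4-sentence-2 already
refuted in dim ≥ 3), Literature lane (lit seat, generation 60, programme R28; parts 1–3 = `Ring2/NonSimpleFivefoldsRows`,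
`Ring2/NonSimpleFivefoldsHodge`, `Ring2/NonSimpleFivefoldsResidual`). Theorems only (no definition, no named fact, no
`sorry`); nothing here assumes HC_CM. NEW as stated (census statements on tree theorems), hence under `Summits/`.

The master theorem of part 2, `isStablyNondegenerate_of_dim_eq_five_of_not_isSimple_of`, displays two rows of Moonen–Zarhin's
§5 as hypotheses: `hST` = (5.10) «`X ∼ Y₁ × Y₂`, `Y₁` a simple abelian surface [of CM type], `Y₂` a simple abelian threefold
[of Type 4] … If `Y₂` is not of CM-type then Lemma (3.6) readily gives `Hg(X) = Hg(Y₁) × Hg(Y₂)`» and `hEET` = (5.11),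
`d_max = 3` «`Y` is isogenous to a product of an elliptic curve `Y₁` and a simple abelian threefold `Y₂` … there does not
exist an embedding of `End⁰(E)` into the center of `End⁰(Y)` … Again by Proposition (3.8) we then find `Hg(X) = Hg(E) ×
Hg(Y)`» (Math. Ann. 315 (1999), chunk p0010 L18–L64 [corpus: paper:arxiv-math_9901113]). The tree now PROVES Prop. (3.8)
for a first factor with ARBITRARY centre (`Literature/AlgebraicGeometry/Motives/HodgeThetaAnnihilatorCentreTimesRankOneTorus`,
`HodgeTheory/CentreTimesCMCurveProductSpan`), whence the row (5.11) BY NAME: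
`Literature.AlgebraicGeometry.HodgeTheory.isStablyNondegenerate_cmCurve_prod_cmCurve_prod_threefold_of_typeIV_of_not_isOfCMType`.
This file substitutes it:

* **`rowEET`** — the hypothesis `hEET` of the master theorem, as a theorem (stated globally); part 2's rows
  `E × (E' × T)` and `E × Z` (`Z` a non-simple fourfold), product not of CM type, outside (e)/(f), WITHOUT the display.
* **`isStablyNondegenerate_of_dim_eq_five_of_not_isSimple_of_rowST`** — every non-simple complex abelian fivefold without
  simple isogeny factor of dimension `4`, outside the printed cases (e)/(f), is stably nondegenerate GIVEN ONLY the row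
  (5.10) `S × T` (`S` a simple CM surface, `T` a simple threefold with a factor of Type IV not of CM type; in print:
  Lemma (3.6) for the `ℚ`-simple rank-two torus `U_F = Hg(S)`, not yet a tree theorem); the residual DICHOTOMY
  `isStablyNondegenerate_or_exists_residualST_of_dim_eq_five_of_not_isSimple` ((D), or `X ∼ S × T` of that shape).
* **`isStablyNondegenerate_of_dim_le_five_of_rowST`** — Moonen–Zarhin Thm. 0.1 (4) AND Thm. 0.2 (4) in one statement for
  `0 < dim X ≤ 5` (not a simple fivefold, no simple fourfold factor, outside (a)/(e)/(f)), modulo the single row (5.10);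
  the Hodge conjecture for all powers; the class target `hcOnClass_avDominatedBy_powSucc_dim_le_five_of_rowST`.

## References

* [MoonenZarhin1999LowDim] B. Moonen, Yu. Zarhin, Math. Ann. 315 (1999) 711–733, Thm. 0.1 (4), Thm. 0.2 (4) with (e)/(f),
  §3 Lemma (3.6), Prop. (3.8), §5 (5.10)–(5.11) [corpus: paper:arxiv-math_9901113 chunks p0001–p0002, p0007, p0010].
  [cite: MoonenZarhin1999LowDim, Thm. 0.2 (4) and §5 (5.10)–(5.11)]
* [MumfordAV1970] D. Mumford, *Abelian Varieties*, §19 Thm. 1 (pp. 173–174). [cite: MumfordAV1970, §19 Thm. 1 (pp. 173–174)]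
* [Deligne2000] P. Deligne, *The Hodge conjecture* (Clay, 2000), §1. [cite: Deligne2000, §1]
-/

noncomputable section

open CategoryTheory CategoryTheory.Limits

namespace Summit.HodgeConjecture.Ring2.NonSimpleFivefolds

open Literature.AlgebraicGeometry.Motives (AbelianVariety)
open Literature.AlgebraicGeometry.Motives.AbelianVariety
open Literature.AlgebraicGeometry.HodgeTheory
open Literature.AlgebraicGeometry.Milne1999
open Summit.HodgeConjecture.CorCM
open Summit.HodgeConjecture.CorCM.Domination
open Summit.HodgeConjecture.HodgeConjecture.Ring2.ClassTargets (HCOnClass)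

variable {X : AbelianVariety ℂ}

/-! ### §1 The row (5.11) as a theorem -/

/-- **The row (5.11), GLOBALLY: `E₁ × (E₂ × T)` is stably nondegenerate** for non-isogenous elliptic curves `E₁, E₂` of
CM type and a simple threefold `T` with a factor of Type IV, not of CM type, admitting neither `End⁰(E₁)` nor `End⁰(E₂)`
(the tree's `isStablyNondegenerate_cmCurve_prod_cmCurve_prod_threefold_of_typeIV_of_not_isOfCMType`: Prop. (3.8) for
`Y = E₂ × T`, centre `k' × k''`). This is the hypothesis `hEET` of `isStablyNondegenerate_of_dim_eq_five_of_not_isSimple_of`.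
[cite: MoonenZarhin1999LowDim, Thm. 0.2 (4), §3 Prop. (3.8) and §5 (5.11)] -/
theorem rowEET : ∀ E₁ E₂ T : AbelianVariety ℂ, E₁.dim = 1 → E₂.dim = 1 → IsOfCMType E₁ → IsOfCMType E₂ →
    ¬ AbelianVariety.IsIsogenous E₁ E₂ → T.dim = 3 → T.IsSimple → ¬ IsOfCMType T → ¬ HasNoTypeIVFactor T →
    IsEmpty (E₁.endAlgebra →+* T.endAlgebra) → IsEmpty (E₂.endAlgebra →+* T.endAlgebra) →
    IsStablyNondegenerate (E₁.prod (E₂.prod T)) :=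
  fun _ _ _ h₁ h₂ c₁ c₂ hni hT3 hTs hTc hT4 i₁ i₂ =>
    isStablyNondegenerate_cmCurve_prod_cmCurve_prod_threefold_of_typeIV_of_not_isOfCMType h₁ h₂ c₁ c₂ hni hT3 hTs hTc hT4
      i₁ i₂

/-- **`E × (E' × T)` for two elliptic curves and a threefold `T`, the product NOT of CM type and outside (e)/(f), is stably
nondegenerate** — part 2's `isStablyNondegenerate_curve_prod_curve_prod_threefold_of_not_isOfCMType_of` with its displayed
row `hEET` discharged by `rowEET`. [cite: MoonenZarhin1999LowDim, §5 (5.6)–(5.9), (5.11) and Prop. (3.8)] -/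
theorem isStablyNondegenerate_curve_prod_curve_prod_threefold_of_not_isOfCMType {E E' T : AbelianVariety ℂ}
    (hE : E.dim = 1) (hE' : E'.dim = 1) (hT3 : T.dim = 3) (hcm : ¬ IsOfCMType (E.prod (E'.prod T)))
    (hna : ¬ ∃ E₀ T₀ : AbelianVariety ℂ, E₀.dim = 1 ∧ IsOfCMType E₀ ∧ T₀.IsSimple ∧ T₀.dim = 3 ∧
      AVDominatedBy E₀ (E.prod (E'.prod T)) ∧ AVDominatedBy T₀ (E.prod (E'.prod T)) ∧
      Nonempty (E₀.endAlgebra →+* T₀.endAlgebra)) :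
    IsStablyNondegenerate (E.prod (E'.prod T)) :=
  isStablyNondegenerate_curve_prod_curve_prod_threefold_of_not_isOfCMType_of hE hE' hT3 hcm hna
    (fun E₁ E₂ T₀ h₁ h₂ c₁ c₂ hni hT3' hTs hTc hT4 i₁ i₂ _ => rowEET E₁ E₂ T₀ h₁ h₂ c₁ c₂ hni hT3' hTs hTc hT4 i₁ i₂)

/-- **`E × Z` for an elliptic curve `E` and a NON-SIMPLE abelian fourfold `Z`, the product NOT of CM type and outside
(e)/(f), is stably nondegenerate** — part 2's `isStablyNondegenerate_curve_prod_fourfold_of_not_isSimple_of_not_isOfCMType_of`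
with `hEET` discharged. [cite: MoonenZarhin1999LowDim, §5 (5.6)–(5.9), (5.11) and Prop. (3.8)] [cite: MumfordAV1970, §19 Thm. 1 (pp. 173–174)] -/
theorem isStablyNondegenerate_curve_prod_fourfold_of_not_isSimple_of_not_isOfCMType {E Z : AbelianVariety ℂ}
    (hE : E.dim = 1) (hZ4 : Z.dim = 4) (hZ : ¬ Z.IsSimple) (hcm : ¬ IsOfCMType (E.prod Z))
    (hna : ¬ ∃ E₀ T₀ : AbelianVariety ℂ, E₀.dim = 1 ∧ IsOfCMType E₀ ∧ T₀.IsSimple ∧ T₀.dim = 3 ∧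
      AVDominatedBy E₀ (E.prod Z) ∧ AVDominatedBy T₀ (E.prod Z) ∧ Nonempty (E₀.endAlgebra →+* T₀.endAlgebra)) :
    IsStablyNondegenerate (E.prod Z) :=
  isStablyNondegenerate_curve_prod_fourfold_of_not_isSimple_of_not_isOfCMType_of hE hZ4 hZ hcm hna
    (fun E₁ E₂ T₀ h₁ h₂ c₁ c₂ hni hT3 hTs hTc hT4 i₁ i₂ _ => rowEET E₁ E₂ T₀ h₁ h₂ c₁ c₂ hni hT3 hTs hTc hT4 i₁ i₂)

/-! ### §2 Non-simple fivefolds modulo the single row (5.10) -/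

/-- **Every non-simple complex abelian fivefold without simple fourfold factor, outside (e)/(f), is stably nondegenerate —
GIVEN ONLY the row (5.10)** (`hST`, relative to `X`: `S` a simple CM surface, `T` a simple threefold with a factor of Type
IV and not of CM type, `S × T ∼ X`). The row (5.11) of the master theorem is discharged by `rowEET`.
[cite: MoonenZarhin1999LowDim, Thm. 0.2 (4) and §5 (5.6)–(5.11)] [cite: MumfordAV1970, §19 Thm. 1 (pp. 173–174)] -/
theorem isStablyNondegenerate_of_dim_eq_five_of_not_isSimple_of_rowST (hX5 : X.dim = 5) (hX : ¬ X.IsSimple)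
    (h4 : ∀ F : AbelianVariety ℂ, F.IsSimple → F.dim = 4 → ¬ AVDominatedBy F X)
    (hna : ¬ ∃ E T : AbelianVariety ℂ, E.dim = 1 ∧ IsOfCMType E ∧ T.IsSimple ∧ T.dim = 3 ∧
      AVDominatedBy E X ∧ AVDominatedBy T X ∧ Nonempty (E.endAlgebra →+* T.endAlgebra))
    (hST : ∀ S T : AbelianVariety ℂ, S.dim = 2 → S.IsSimple → IsOfCMType S → T.dim = 3 → T.IsSimple →
      ¬ IsOfCMType T → ¬ HasNoTypeIVFactor T → AbelianVariety.IsIsogenous (S.prod T) X → IsStablyNondegenerate (S.prod T)) :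
    IsStablyNondegenerate X :=
  isStablyNondegenerate_of_dim_eq_five_of_not_isSimple_of hX5 hX h4 hna hST
    (fun E₁ E₂ T h₁ h₂ c₁ c₂ hni hT3 hTs hTc hT4 i₁ i₂ _ => rowEET E₁ E₂ T h₁ h₂ c₁ c₂ hni hT3 hTs hTc hT4 i₁ i₂)

/-- **The EXACT residual shape, now single.** A non-simple complex abelian fivefold without simple fourfold factor, outside
(e)/(f), is stably nondegenerate OR isogenous to `S × T` with `S` a simple CM surface and `T` a simple threefold with a
factor of Type IV and not of CM type (Moonen–Zarhin (5.10); in print by Lemma (3.6) for the `ℚ`-simple torus `U_F`).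
[cite: MoonenZarhin1999LowDim, Thm. 0.2 (4), §3 Lemma (3.6) and §5 (5.10)] -/
theorem isStablyNondegenerate_or_exists_residualST_of_dim_eq_five_of_not_isSimple (hX5 : X.dim = 5) (hX : ¬ X.IsSimple)
    (h4 : ∀ F : AbelianVariety ℂ, F.IsSimple → F.dim = 4 → ¬ AVDominatedBy F X)
    (hna : ¬ ∃ E T : AbelianVariety ℂ, E.dim = 1 ∧ IsOfCMType E ∧ T.IsSimple ∧ T.dim = 3 ∧
      AVDominatedBy E X ∧ AVDominatedBy T X ∧ Nonempty (E.endAlgebra →+* T.endAlgebra)) :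
    IsStablyNondegenerate X ∨
      ∃ S T : AbelianVariety ℂ, S.dim = 2 ∧ S.IsSimple ∧ IsOfCMType S ∧ T.dim = 3 ∧ T.IsSimple ∧ ¬ IsOfCMType T ∧
        ¬ HasNoTypeIVFactor T ∧ AbelianVariety.IsIsogenous (S.prod T) X := by
  by_cases hS : ∃ S T : AbelianVariety ℂ, S.dim = 2 ∧ S.IsSimple ∧ IsOfCMType S ∧ T.dim = 3 ∧ T.IsSimple ∧
      ¬ IsOfCMType T ∧ ¬ HasNoTypeIVFactor T ∧ AbelianVariety.IsIsogenous (S.prod T) X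
  · exact Or.inr hS
  refine Or.inl (isStablyNondegenerate_of_dim_eq_five_of_not_isSimple_of_rowST hX5 hX h4 hna ?_)
  intro S T hS2 hSs hSc hT3 hTs hTc hT4 hrel
  exact absurd ⟨S, T, hS2, hSs, hSc, hT3, hTs, hTc, hT4, hrel⟩ hS

/-- **The Hodge conjecture for all powers, or the residual shape (5.10).** [cite: MoonenZarhin1999LowDim, Thm. 0.2 (4) and §5 (5.10)] -/
theorem hodgeConjectureFor_powSucc_or_exists_residualST_of_dim_eq_five_of_not_isSimple (hX5 : X.dim = 5)
    (hX : ¬ X.IsSimple) (h4 : ∀ F : AbelianVariety ℂ, F.IsSimple → F.dim = 4 → ¬ AVDominatedBy F X)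
    (hna : ¬ ∃ E T : AbelianVariety ℂ, E.dim = 1 ∧ IsOfCMType E ∧ T.IsSimple ∧ T.dim = 3 ∧
      AVDominatedBy E X ∧ AVDominatedBy T X ∧ Nonempty (E.endAlgebra →+* T.endAlgebra)) :
    (∀ N : ℕ, HodgeConjectureFor (X.powSucc N).dim (X.powSucc N).X) ∨
      ∃ S T : AbelianVariety ℂ, S.dim = 2 ∧ S.IsSimple ∧ IsOfCMType S ∧ T.dim = 3 ∧ T.IsSimple ∧ ¬ IsOfCMType T ∧
        ¬ HasNoTypeIVFactor T ∧ AbelianVariety.IsIsogenous (S.prod T) X := by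
  rcases isStablyNondegenerate_or_exists_residualST_of_dim_eq_five_of_not_isSimple hX5 hX h4 hna with hD | hS
  · exact Or.inl fun N => hD.hodgeConjectureFor_powSucc N
  · exact Or.inr hS

/-- **The master theorem with the single row (5.10) stated GLOBALLY** (the shape a future tree theorem «Lemma (3.6) for
the rank-two torus `U_F`» discharges). [cite: MoonenZarhin1999LowDim, Thm. 0.2 (4) and §5 (5.10)] -/
theorem isStablyNondegenerate_of_dim_eq_five_of_not_isSimple_of_rowST'
    (hST : ∀ S T : AbelianVariety ℂ, S.dim = 2 → S.IsSimple → IsOfCMType S → T.dim = 3 → T.IsSimple → ¬ IsOfCMType T →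
      ¬ HasNoTypeIVFactor T → IsStablyNondegenerate (S.prod T))
    (hX5 : X.dim = 5) (hX : ¬ X.IsSimple) (h4 : ∀ F : AbelianVariety ℂ, F.IsSimple → F.dim = 4 → ¬ AVDominatedBy F X)
    (hna : ¬ ∃ E T : AbelianVariety ℂ, E.dim = 1 ∧ IsOfCMType E ∧ T.IsSimple ∧ T.dim = 3 ∧
      AVDominatedBy E X ∧ AVDominatedBy T X ∧ Nonempty (E.endAlgebra →+* T.endAlgebra)) :
    IsStablyNondegenerate X :=
  isStablyNondegenerate_of_dim_eq_five_of_not_isSimple_of_rowST hX5 hX h4 hna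
    (fun S T hS2 hSs hSc hT3 hTs hTc hT4 _ => hST S T hS2 hSs hSc hT3 hTs hTc hT4)

/-! ### §3 Dimension `≤ 5` modulo the single row (5.10) -/

/-- **Moonen–Zarhin Thm. 0.1 (4) and Thm. 0.2 (4), unified, modulo the single row (5.10)**: every complex abelian variety
`X` with `0 < dim X ≤ 5`, not a simple fivefold, with no simple isogeny factor of dimension `4`, outside the printed cases
(a)/(e)/(f), and granting the row (5.10) relative to `X` (vacuous unless `dim X = 5`), satisfies `B•(Xⁿ) = D•(Xⁿ)` for
all `n`. [cite: MoonenZarhin1999LowDim, Thm. 0.1 (4) and Thm. 0.2 (4)] [cite: MumfordAV1970, §19 Thm. 1 (pp. 173–174)] -/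
theorem isStablyNondegenerate_of_dim_le_five_of_rowST (h0 : 0 < X.dim) (h5 : X.dim ≤ 5) (hX : X.dim = 5 → ¬ X.IsSimple)
    (h4 : ∀ F : AbelianVariety ℂ, F.IsSimple → F.dim = 4 → ¬ AVDominatedBy F X)
    (hna : ¬ ∃ E T : AbelianVariety ℂ, E.dim = 1 ∧ IsOfCMType E ∧ T.IsSimple ∧ T.dim = 3 ∧
      AVDominatedBy E X ∧ AVDominatedBy T X ∧ Nonempty (E.endAlgebra →+* T.endAlgebra))
    (hST : ∀ S T : AbelianVariety ℂ, S.dim = 2 → S.IsSimple → IsOfCMType S → T.dim = 3 → T.IsSimple →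
      ¬ IsOfCMType T → ¬ HasNoTypeIVFactor T → AbelianVariety.IsIsogenous (S.prod T) X → IsStablyNondegenerate (S.prod T)) :
    IsStablyNondegenerate X :=
  isStablyNondegenerate_of_dim_le_five_of h0 h5 hX h4 hna hST
    (fun E₁ E₂ T h₁ h₂ c₁ c₂ hni hT3 hTs hTc hT4 i₁ i₂ _ => rowEET E₁ E₂ T h₁ h₂ c₁ c₂ hni hT3 hTs hTc hT4 i₁ i₂)

/-- **The Hodge conjecture for every power of every such `X`** — UNCONDITIONAL apart from the single row (5.10).
[cite: MoonenZarhin1999LowDim, Thm. 0.1 (4) and Thm. 0.2 (4)] -/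
theorem hodgeConjectureFor_powSucc_of_dim_le_five_of_rowST (h0 : 0 < X.dim) (h5 : X.dim ≤ 5)
    (hX : X.dim = 5 → ¬ X.IsSimple) (h4 : ∀ F : AbelianVariety ℂ, F.IsSimple → F.dim = 4 → ¬ AVDominatedBy F X)
    (hna : ¬ ∃ E T : AbelianVariety ℂ, E.dim = 1 ∧ IsOfCMType E ∧ T.IsSimple ∧ T.dim = 3 ∧
      AVDominatedBy E X ∧ AVDominatedBy T X ∧ Nonempty (E.endAlgebra →+* T.endAlgebra))
    (hST : ∀ S T : AbelianVariety ℂ, S.dim = 2 → S.IsSimple → IsOfCMType S → T.dim = 3 → T.IsSimple →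
      ¬ IsOfCMType T → ¬ HasNoTypeIVFactor T → AbelianVariety.IsIsogenous (S.prod T) X → IsStablyNondegenerate (S.prod T))
    (N : ℕ) : HodgeConjectureFor (X.powSucc N).dim (X.powSucc N).X :=
  (isStablyNondegenerate_of_dim_le_five_of_rowST h0 h5 hX h4 hna hST).hodgeConjectureFor_powSucc N

/-- **Class target, modulo the single row (5.10) stated GLOBALLY: the Hodge conjecture on everything dominated by a power
of a complex abelian variety of dimension `≤ 5`, not a simple fivefold, without simple fourfold isogeny factor, outside the
printed (a)/(e)/(f)** — the row `hST` is the only non-kernel input left. [cite: MoonenZarhin1999LowDim, Thm. 0.1 (4) and Thm. 0.2 (4)]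
[cite: Deligne2000, §1] -/
theorem hcOnClass_avDominatedBy_powSucc_dim_le_five_of_rowST
    (hST : ∀ S T : AbelianVariety ℂ, S.dim = 2 → S.IsSimple → IsOfCMType S → T.dim = 3 → T.IsSimple → ¬ IsOfCMType T →
      ¬ HasNoTypeIVFactor T → IsStablyNondegenerate (S.prod T)) :
    HCOnClass fun B => ∃ (X : AbelianVariety ℂ) (N : ℕ), 0 < X.dim ∧ X.dim ≤ 5 ∧ (X.dim = 5 → ¬ X.IsSimple) ∧
      (∀ F : AbelianVariety ℂ, F.IsSimple → F.dim = 4 → ¬ AVDominatedBy F X) ∧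
      (¬ ∃ E T : AbelianVariety ℂ, E.dim = 1 ∧ IsOfCMType E ∧ T.IsSimple ∧ T.dim = 3 ∧
        AVDominatedBy E X ∧ AVDominatedBy T X ∧ Nonempty (E.endAlgebra →+* T.endAlgebra)) ∧
      AVDominatedBy B (X.powSucc N) :=
  hcOnClass_avDominatedBy_powSucc_dim_le_five_of_rows hST rowEET

end Summit.HodgeConjecture.Ring2.NonSimpleFivefolds
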